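import Mathlib
import Summits.PneNP.PneNP.Theorems.ConvexRankGatesConvexGateBlindAffinePencilTwoWitness

/-!
# PneNP / ConvexRankGates — `ConvexGateBlind`: a valid 2 × 2 pencil excludes at most `2n(n−1)/(k−1)² + 1` bare cliques

Helpers (`--supports stmt-PneNP-10680`), COLUMN-SPACE line (prover seat 2, session 26), PSD side: the FIRST UPPER BOUND on the
pencil exclusion number (memo ANALYSIS-seat2-s26 §3.1), `n = C(m,2)` the number of edges:

* `two_pencil_exclusion_bound` (registered) — **if a `2 × 2` affine pencil `H(x) = H₀ − Σ_e x_e H_e` is positive semidefinite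
  on every `k`-clique-free graph of `K_m` (`k ≥ 3`) and `c` bare `k`-cliques have `H(1_{E(Q)}) ⋡ 0`, then
  `(c − 1)(k − 1)² ≤ 2(n² − n)`**, i.e. `c(2; m, k) ≤ 2n(n−1)/(k−1)² + 1 ≤ m⁴/(2(k−1)²) + 1`.

Proof (the circle argument). Sort the excluded cliques by their half-circle witness parameters
`t_1 < ⋯ < t_c` in `(−1, 1]` (`…TwoWitness.lean`: distinct cliques have distinct parameters). Consecutive cliques
`Q_i ≠ Q_{i+1}` have `≥ k − 1` private edges each (`le_card_cliqueEdges_sdiff`), so `≥ (k−1)²` ordered pairs `(e, e')` with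
`e ∈ E(Q_i) ∖ E(Q_{i+1})`, `e' ∈ E(Q_{i+1}) ∖ E(Q_i)`; by the swap lemma the pair form `y(t)ᵀ(H_e − H_{e'})y(t)` is positive
at `t_i` and negative at `t_{i+1}`. It is an affine function of the doubled point of the circle, so it changes sign `+ → −`
on at most TWO of the disjoint intervals `[t_i, t_{i+1}]` (`…Circle.lean`). Double counting the incidences (pair, interval)
gives `(c−1)(k−1)² ≤ 2·#{ordered pairs of distinct edges} = 2n(n−1)`. So `c(2) = O(m⁴/k²)`: polynomial, as Conjecture C of
the memo (`c(q) ≤ q·m^{O(1)}`) predicts for `q = 2` (constructions: `≍ m²/k²` packings, `m − k + 1` books). [new]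
-/

set_option linter.dupNamespace false

namespace Summit.PneNP.PneNP.Theorems

open Finset Real Matrix Literature.Computability.Complexity
open Summit.PneNP.PneNP.Cruxes.ConvexGateBlind.StrictRankConicCover (Edge cdist)

noncomputable section

variable {m : ℕ}

/-! ## Private edges of distinct `k`-sets -/

/-- **Distinct `k`-sets have at least `k − 1` private edges**: for `x ∈ Q ∖ Q'` the edges `{x, y}`, `y ∈ Q ∖ {x}`, lie in
`E(Q) ∖ E(Q')`. [folklore] -/
theorem le_card_cliqueEdges_sdiff {k : ℕ} {Q Q' : Finset (Fin m)} (hQ : Q.card = k) (hQ' : Q'.card = k) (hne : Q ≠ Q') :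
    k - 1 ≤ (cliqueEdges Q \ cliqueEdges Q').card := by
  classical
  have hnot : ¬ Q ⊆ Q' := fun h => hne (Finset.eq_of_subset_of_card_le h (by rw [hQ, hQ']))
  obtain ⟨x, hxQ, hxQ'⟩ := Finset.not_subset.1 hnot
  -- the star of `x` inside `Q`
  set f : {y // y ∈ Q.erase x} → Edge m := fun y =>
    ⟨s(x, y.1), by simpa using (Finset.ne_of_mem_erase y.2).symm⟩ with hf
  have hinj : Function.Injective f := by
    rintro ⟨y, hy⟩ ⟨y', hy'⟩ h
    have h' : s(x, y) = s(x, y') := congrArg Subtype.val h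
    exact Subtype.ext (Sym2.congr_right.1 h')
  have hsub : (Q.erase x).attach.image f ⊆ cliqueEdges Q \ cliqueEdges Q' := by
    intro e he
    rw [mem_image] at he
    obtain ⟨⟨y, hy⟩, -, rfl⟩ := he
    obtain ⟨hyx, hyQ⟩ := Finset.mem_erase.1 hy
    rw [mem_sdiff, mk_mem_cliqueEdges (Ne.symm hyx), mk_mem_cliqueEdges (Ne.symm hyx)]
    exact ⟨⟨hxQ, hyQ⟩, fun h => hxQ' h.1⟩
  calc k - 1 = (Q.erase x).card := by rw [card_erase_of_mem hxQ, hQ]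
    _ = ((Q.erase x).attach.image f).card := by rw [card_image_of_injective _ hinj, card_attach]
    _ ≤ _ := card_le_card hsub

/-! ## The excluded cliques and their sorted parameters -/

section Bound

variable {k : ℕ} (H₀ : Matrix (Fin 2) (Fin 2) ℝ) (He : Edge m → Matrix (Fin 2) (Fin 2) ℝ)

open Classical in
/-- The excluded `k`-sets of the pencil. [new] -/
def exclSet (k : ℕ) : Finset (Finset (Fin m)) :=
  ((Finset.univ : Finset (Fin m)).powersetCard k).filter fun Q => ¬ (pen2 H₀ He (cliqueVec Q)).PosSemidef

/-- Membership in `exclSet`. [folklore] -/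
theorem mem_exclSet {Q : Finset (Fin m)} :
    Q ∈ exclSet H₀ He k ↔ Q.card = k ∧ ¬ (pen2 H₀ He (cliqueVec Q)).PosSemidef := by
  classical
  simp [exclSet, mem_powersetCard]

/-- The set of witness parameters. [new] -/
def paramSet (k : ℕ) : Finset ℝ := (exclSet H₀ He k).image (twoWit H₀ He)

open Classical in
/-- The excluded clique with a given parameter (`∅` if none). [new] -/
def cliqueAt (k : ℕ) (t : ℝ) : Finset (Fin m) :=
  if h : ∃ Q ∈ exclSet H₀ He k, twoWit H₀ He Q = t then Classical.choose h else ∅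

/-- The clique at a parameter of `paramSet` is excluded and has that parameter. [folklore] -/
theorem cliqueAt_spec {t : ℝ} (ht : t ∈ paramSet H₀ He k) :
    cliqueAt H₀ He k t ∈ exclSet H₀ He k ∧ twoWit H₀ He (cliqueAt H₀ He k t) = t := by
  have h : ∃ Q ∈ exclSet H₀ He k, twoWit H₀ He Q = t := by
    obtain ⟨Q, hQ, hQt⟩ := mem_image.1 ht; exact ⟨Q, hQ, hQt⟩
  rw [cliqueAt, dif_pos h]
  exact Classical.choose_spec h

variable (hk : 3 ≤ k) (hvalid : ∀ u : Edge m → Bool, cliqueFn m k u = false → (pen2 H₀ He u).PosSemidef)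
include hk hvalid

/-- The parameter map is injective on the excluded cliques, so `#paramSet = #exclSet`. [folklore] -/
theorem card_paramSet : (paramSet H₀ He k).card = (exclSet H₀ He k).card := by
  refine card_image_of_injOn fun Q hQ Q' hQ' h => ?_
  rw [Finset.mem_coe, mem_exclSet] at hQ hQ'
  exact twoWit_injOn hk H₀ He hvalid hQ.1 hQ'.1 hQ.2 hQ'.2 h

/-- Parameters lie in `(−1, 1]`. [folklore] -/
theorem paramSet_mem_Ioc {t : ℝ} (ht : t ∈ paramSet H₀ He k) : t ∈ Set.Ioc (-1 : ℝ) 1 := by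
  obtain ⟨hQ, hQt⟩ := cliqueAt_spec H₀ He ht
  rw [mem_exclSet] at hQ
  rw [← hQt]
  exact (twoWit_spec hk H₀ He hvalid hQ.2).1

/-- **Consecutive parameters and a private pair give a `+ → −` sign change of the pair form.** [new] -/
theorem pairForm_signs {s t : ℝ} (hs : s ∈ paramSet H₀ He k) (ht : t ∈ paramSet H₀ He k) {e e' : Edge m}
    (he : e ∈ cliqueEdges (cliqueAt H₀ He k s) \ cliqueEdges (cliqueAt H₀ He k t))
    (he' : e' ∈ cliqueEdges (cliqueAt H₀ He k t) \ cliqueEdges (cliqueAt H₀ He k s)) :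
    0 < pairForm He e e' s ∧ pairForm He e e' t < 0 := by
  obtain ⟨hQs, hs'⟩ := cliqueAt_spec H₀ He hs
  obtain ⟨hQt, ht'⟩ := cliqueAt_spec H₀ He ht
  rw [mem_exclSet] at hQs hQt
  rw [mem_sdiff] at he he'
  have memE : ∀ {Q : Finset (Fin m)} {f : Edge m}, f ∈ cliqueEdges Q ↔ cliqueVec Q f = true := by
    intro Q f; simp [cliqueEdges]
  have he1 : cliqueVec (cliqueAt H₀ He k s) e = true := memE.1 he.1
  have he2 : cliqueVec (cliqueAt H₀ He k t) e = false := by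
    simpa using (mt memE.2 he.2)
  have he'1 : cliqueVec (cliqueAt H₀ He k t) e' = true := memE.1 he'.1
  have he'2 : cliqueVec (cliqueAt H₀ He k s) e' = false := by
    simpa using (mt memE.2 he'.2)
  constructor
  · rw [← hs']
    exact pairForm_pos_of_excluded hk H₀ He hvalid hQs.1 hQs.2 he1 he'2
  · rw [← ht']
    exact pairForm_neg_of_excluded hk H₀ He hvalid hQt.1 hQt.2 he2 he'1

/-! ## The counting -/

/-- With `c' + 1` excluded cliques sorted by parameter, the private pairs of the `c'` consecutive couples satisfy
`c'·(k−1)² ≤ 2·#(ordered pairs of distinct edges)`. [new] -/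
theorem consecutive_count {c' : ℕ} (hc : (paramSet H₀ He k).card = c' + 1) :
    c' * (k - 1) ^ 2 ≤ 2 * ((Finset.univ : Finset (Edge m)).offDiag).card := by
  classical
  set P := paramSet H₀ He k with hP
  set f : Fin (c' + 1) ↪o ℝ := P.orderEmbOfFin hc with hf
  have hfmem : ∀ i, f i ∈ P := fun i => P.orderEmbOfFin_mem hc i
  -- consecutive couples
  set lo : Fin c' → Finset (Fin m) := fun i => cliqueAt H₀ He k (f i.castSucc) with hlo
  set hi : Fin c' → Finset (Fin m) := fun i => cliqueAt H₀ He k (f i.succ) with hhi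
  set Priv : Fin c' → Finset (Edge m × Edge m) := fun i =>
    (cliqueEdges (lo i) \ cliqueEdges (hi i)) ×ˢ (cliqueEdges (hi i) \ cliqueEdges (lo i)) with hPriv
  set T : Finset (Edge m × Edge m) := (Finset.univ : Finset (Edge m)).offDiag with hT
  set r : Fin c' → Edge m × Edge m → Prop := fun i p => p ∈ Priv i with hr
  -- (a) each couple has at least `(k−1)²` private pairs, all off-diagonal
  have hlohi : ∀ i, lo i ≠ hi i := by
    intro i heq
    have h1 := (cliqueAt_spec H₀ He (hfmem i.castSucc)).2
    have h2 := (cliqueAt_spec H₀ He (hfmem i.succ)).2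
    have : f i.castSucc = f i.succ := by rw [← h1, ← h2]; exact congrArg _ heq
    have hlt : f i.castSucc < f i.succ := f.strictMono (Fin.castSucc_lt_succ (i := i))
    rw [this] at hlt; exact lt_irrefl _ hlt
  have hcard_lo : ∀ i, (lo i).card = k := fun i =>
    ((mem_exclSet H₀ He).1 (cliqueAt_spec H₀ He (hfmem i.castSucc)).1).1
  have hcard_hi : ∀ i, (hi i).card = k := fun i =>
    ((mem_exclSet H₀ He).1 (cliqueAt_spec H₀ He (hfmem i.succ)).1).1
  have habove : ∀ i, (k - 1) ^ 2 ≤ (T.bipartiteAbove r i).card := by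
    intro i
    have hsubT : Priv i ⊆ T := by
      intro p hp
      simp only [hPriv, mem_product, mem_sdiff] at hp
      rw [hT, mem_offDiag]
      exact ⟨mem_univ _, mem_univ _, fun h => hp.2.2 (h ▸ hp.1.1)⟩
    have heq : T.bipartiteAbove r i = Priv i := by
      ext p
      simp only [Finset.bipartiteAbove, mem_filter, hr]
      exact ⟨fun h => h.2, fun h => ⟨hsubT h, h⟩⟩
    rw [heq, hPriv, card_product, sq]
    exact Nat.mul_le_mul (le_card_cliqueEdges_sdiff (hcard_lo i) (hcard_hi i) (hlohi i))
      (le_card_cliqueEdges_sdiff (hcard_hi i) (hcard_lo i) (Ne.symm (hlohi i)))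
  -- (b) each ordered pair is private for at most two couples
  have hbelow : ∀ p ∈ T, ((Finset.univ : Finset (Fin c')).bipartiteBelow r p).card ≤ 2 := by
    rintro ⟨e, e'⟩ hp
    by_contra h3
    rw [not_le, Finset.two_lt_card] at h3
    obtain ⟨a, ha, b, hb, d, hd, hab, had, hbd⟩ := h3
    simp only [Finset.bipartiteBelow, mem_filter, mem_univ, true_and, hr] at ha hb hd
    -- sign change of the pair form on `[f i.castSucc, f i.succ]` for each of the three couples
    have sgn : ∀ i : Fin c', (e, e') ∈ Priv i →
        0 < pairForm He e e' (f i.castSucc) ∧ pairForm He e e' (f i.succ) < 0 := by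
      intro i hi'
      simp only [hPriv, mem_product] at hi'
      exact pairForm_signs H₀ He hk hvalid (hfmem i.castSucc) (hfmem i.succ) hi'.1 hi'.2
    -- order the three indices
    have key : ∀ i j l : Fin c', i < j → j < l → (e, e') ∈ Priv i → (e, e') ∈ Priv j → (e, e') ∈ Priv l → False := by
      intro i j l hij hjl hi' hj' hl'
      obtain ⟨pi, ni⟩ := sgn i hi'
      obtain ⟨pj, nj⟩ := sgn j hj'
      obtain ⟨pl, nl⟩ := sgn l hl'
      have m1 := paramSet_mem_Ioc H₀ He hk hvalid (hfmem i.castSucc)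
      have m3 := paramSet_mem_Ioc H₀ He hk hvalid (hfmem l.succ)
      refine circleAffine_signChanges_le_two (f.strictMono (Fin.castSucc_lt_succ (i := i))) ?_
        (f.strictMono (Fin.castSucc_lt_succ (i := j))) ?_ (f.strictMono (Fin.castSucc_lt_succ (i := l))) m1.1 m3.2
        pi ni pj nj pl nl
      · exact f.monotone (Fin.succ_le_castSucc_iff.2 hij)
      · exact f.monotone (Fin.succ_le_castSucc_iff.2 hjl)
    rcases lt_or_gt_of_ne hab with h1 | h1 <;> rcases lt_or_gt_of_ne had with h2 | h2 <;>
      rcases lt_or_gt_of_ne hbd with h3 | h3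
    · exact key a b d h1 h3 ha hb hd
    · exact key a d b h2 h3 ha hd hb
    · exact lt_irrefl _ ((h2.trans h1).trans h3)
    · exact key d a b h2 h1 hd ha hb
    · exact key b a d h1 h2 hb ha hd
    · exact lt_irrefl _ ((h1.trans h2).trans h3)
    · exact key b d a h3 h2 hb hd ha
    · exact key d b a h3 h1 hd hb ha
  -- (c) double counting
  have hdc := Finset.sum_card_bipartiteAbove_eq_sum_card_bipartiteBelow (s := (Finset.univ : Finset (Fin c')))
    (t := T) (r := r)
  have hL : c' * (k - 1) ^ 2 ≤ ∑ i : Fin c', (T.bipartiteAbove r i).card := by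
    calc c' * (k - 1) ^ 2 = ∑ _i : Fin c', (k - 1) ^ 2 := by simp
      _ ≤ _ := Finset.sum_le_sum fun i _ => habove i
  have hR : ∑ p ∈ T, ((Finset.univ : Finset (Fin c')).bipartiteBelow r p).card ≤ 2 * T.card := by
    calc ∑ p ∈ T, ((Finset.univ : Finset (Fin c')).bipartiteBelow r p).card ≤ ∑ _p ∈ T, 2 :=
          Finset.sum_le_sum hbelow
      _ = 2 * T.card := by rw [sum_const, smul_eq_mul, mul_comm]
  calc c' * (k - 1) ^ 2 ≤ ∑ i : Fin c', (T.bipartiteAbove r i).card := hL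
    _ = ∑ p ∈ T, ((Finset.univ : Finset (Fin c')).bipartiteBelow r p).card := hdc
    _ ≤ 2 * T.card := hR

/-- **The exclusion number of a valid `2 × 2` pencil**: `(#excluded − 1)·(k−1)² ≤ 2·(n² − n)`, `n` the number of edges. [new] -/
theorem card_exclSet_bound :
    ((exclSet H₀ He k).card - 1) * (k - 1) ^ 2 ≤
      2 * (Fintype.card (Edge m) * Fintype.card (Edge m) - Fintype.card (Edge m)) := by
  classical
  rw [← card_paramSet H₀ He hk hvalid]
  rcases Nat.eq_zero_or_pos (paramSet H₀ He k).card with h0 | hpos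
  · rw [h0]; simp
  · obtain ⟨c', hc⟩ : ∃ c', (paramSet H₀ He k).card = c' + 1 := ⟨_, (Nat.succ_pred_eq_of_pos hpos).symm⟩
    rw [hc, Nat.add_sub_cancel]
    have h := consecutive_count H₀ He hk hvalid hc
    rw [Finset.offDiag_card, Finset.card_univ] at h
    exact h

end Bound

open Classical in
/-- **A valid 2 × 2 pencil excludes at most `2n(n−1)/(k−1)² + 1` bare `k`-cliques** (registered form): if
`H(x) = H₀ − Σ_e x_e H_e` (`2 × 2`) is positive semidefinite on every `k`-clique-free graph of `K_m`, `k ≥ 3`, then the number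
`c` of `k`-sets `Q` with `H(1_{E(Q)}) ⋡ 0` satisfies `(c − 1)(k − 1)² ≤ 2(n·n − n)`, `n = #E(K_m)` — the first upper bound on
the pencil exclusion number beyond `q = 1` (`c(2; m,k) = O(m⁴/k²)`). [new] -/
theorem two_pencil_exclusion_bound : ∀ {m k : ℕ}, 3 ≤ k → ∀ (H₀ : Matrix (Fin 2) (Fin 2) ℝ) (He : Edge m → Matrix (Fin 2) (Fin 2) ℝ), (∀ u : Edge m → Bool, cliqueFn m k u = false → (H₀ - ∑ e, if u e = true then He e else 0).PosSemidef) → ((((Finset.univ : Finset (Fin m)).powersetCard k).filter fun Q => ¬ (H₀ - ∑ e, if cliqueVec Q e = true then He e else 0).PosSemidef).card - 1) * (k - 1) ^ 2 ≤ 2 * (Fintype.card (Edge m) * Fintype.card (Edge m) - Fintype.card (Edge m)) :=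
  fun hk H₀ He hvalid => card_exclSet_bound H₀ He hk hvalid

end

end Summit.PneNP.PneNP.Theorems
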